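import Mathlib.Analysis.Convex.SpecificFunctions.Basic
import Mathlib.Analysis.SpecialFunctions.Pow.Real

/-!
# RemainderExplicitHistoryDiagonalRatePowerShapes — ROAD P3, ORDER-0 PROFILE FAMILY: THE SHAPE CONSTANTS OF THE RATE THEOREM FOR POWER
# TAILS OF ANY EXPONENT `0 < q < 1` — Bernoulli's inequality for real exponents gives the `q`-head `Σ_{i<N} 1∕(i+1)^q ≤ N^{1−q}∕(1−q)` and the
# `(1+q)`-tail `Σ_{v≥2} 1∕(v^q·v) ≤ 1∕q`; Abel summation turns a tail majorant `R(N) − R(k) ≤ τ(k)` into the `min(a,K)²`-moment bound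
# `Σ_{a<N} ρ(a)min(a,K)² ≤ Σ_{k<K} (2k+1)τ(k+1)`; hence for `τ(k) = T₀∕(k+1)^q` the third file's shapes hold with `A₁ = 4` and
# `A₂ = T₀(4∕(1−q) + 2∕q)` (seventh file of station S-d4p3-g49-1 «the rate in the cutoff»; pure real analysis, Mathlib only; the eighth file
# reads off the rate `√m∕n^q` for every profile with power tails)

Cell `pub-balaban`, β-function sub-cell, BINDER row D4 «RemainderConst leaves for Bałaban's split» (`HOME/BINDER-OWNERS.md`; owner
lineage `b2b-balaban-beta-an4`; this file by co-owner #3 lineage `b2b-balaban-beta-d4-p3`, road P3 «the reduction road», generation 49,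
station S-d4p3-g49-1, seventh file; imports Mathlib only — `Analysis.Convex.SpecificFunctions.Basic` for Bernoulli's inequality with a real
exponent, `rpow_one_add_le_one_add_mul_self`), β-FLOW TEAM duty (1); FREEZE (0) honoured (def-free module in road P3's own
`RemainderExplicit*` series; no leaf, no interface, no Literature file).  Pure real analysis; nothing of [Balaban1987RG1] enters.

HONEST FRAMING (page 1 of everything the β sub-cell writes).  *"Discharging BetaPertH makes Bałaban's UV stability UNCONDITIONAL — a real
constructive-QFT result; it is NOT the continuum limit and NOT the Clay problem."*  THIS FILE DISCHARGES NOTHING OF THE KIND.  The third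
file's rate theorem (`RemainderExplicitHistoryDiagonalRate.astar_sub_invSq_le_rate`) is stated for an abstract tail majorant `τ` with two
shape hypotheses — (T1) `Σ_{a<N} ρ(a)min(a,K)² ≤ A₁K²τ(K)` and (T2) `Σ_{i<j₀} τ(i+1)τ(j₀−i)∕(j₀+1−i) ≤ A₂τ(j₀+1)` — and the fifth file
instantiated them at the borderline exponent `q = 1∕2` with square roots.  This file supplies the constants for EVERY exponent `0 < q < 1`
(road P3's polynomial profiles `ρ(a) ≍ a^{−p}`, `1 < p < 2`, have tails `≍ k^{1−p}`, `q = p − 1`): §1 the two one-dimensional sums by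
Bernoulli's inequality `(1+s)^r ≤ 1 + rs` (`0 ≤ r ≤ 1`, `s ≥ −1`) — `(1−q)∕(i+1)^q ≤ (i+1)^{1−q} − i^{1−q}` telescopes to the `q`-HEAD, and
`q∕(v^q·v) ≤ 1∕(v−1)^q − 1∕v^q` (`v ≥ 2`) to the `(1+q)`-TAIL; §2 Abel summation (`min(a,K)² = Σ_{k<K} [k<a](2k+1)`) of the `min²`-moment
against the tails — so (T1) follows from a tail majorant ALONE and g48's `borderline_minSq_le` was not needed in kind; §3 the two shapes:
(T1) with `A₁ = 4` (`(2k+1)∕(k+2)^q ≤ 2(K+1)^{1−q}`), (T2) with `A₂ = T₀(4∕(1−q) + 2∕q)` (young positions against the head, old ones against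
the tail, split at `j₀∕2`, as in the fifth file).  Nothing of Bałaban's (1.22) is asserted or constructed; row D4 class UNCHANGED
(critical-path width 0; instance 0∕1; D4 DISCHARGE NO DATE); NOT B12 Thm 2, NOT BetaPertH, NOT continuum, NOT Clay.  HONEST DEPENDENCY:
continuum YM on T⁴ ⇐ BetaPertH ∧ nine spine estimates (0/9 proved); BetaPertH ⇐ (D1) ∧ (D4) ∧ CAP+tail; G-an2-4 gates asym, D1 and NE2/3/4.
ABSOLUTE RULE: nothing is cited as a fact.

WHAT IS PROVED ([folklore]; 0 sorry; 0 `def`).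
* §1 `head_step`, **`sum_head_le`** (`Σ_{i<N} 1∕(i+1)^q ≤ N^{1−q}∕(1−q)`), `tail_step`, **`sum_tail_le`** (`Σ_{t<N} 1∕((t+2)^q(t+2)) ≤ 1∕q`).
* §2 `minSq_eq_sum`, **`sum_minSq_eq`** (`Σ_{a<N} ρ(a)min(a,K)² = Σ_{k<K}(2k+1)Σ_{a∈[k+1,N)} ρ(a)`), **`sum_minSq_le_tails`**.
* §3 `rpow_one_sub_eq`, **`powerTail_T1`** (`A₁ = 4`), **`powerTail_T2`** (`A₂ = T₀(4∕(1−q) + 2∕q)`).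
-/

noncomputable section

open Finset

namespace Summit.QuantumFields.BalabanUV.Beta.RemainderExplicitHistoryDiagonalRatePowerShapes

/-! ## §1 Two one-dimensional sums by Bernoulli's inequality with a real exponent -/

/-- BERNOULLI STEP FOR THE `q`-HEAD: for `0 < q < 1` and a natural `i`, `(1−q)∕(i+1)^q ≤ (i+1)^{1−q} − i^{1−q}`. [folklore] -/
theorem head_step {q : ℝ} (hq0 : 0 < q) (hq1 : q < 1) (i : ℕ) :
    (1 - q) / ((i : ℝ) + 1) ^ q ≤ ((i : ℝ) + 1) ^ (1 - q) - (i : ℝ) ^ (1 - q) := by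
  have hx : (0 : ℝ) < (i : ℝ) + 1 := by positivity
  have hxq : 0 < ((i : ℝ) + 1) ^ q := Real.rpow_pos_of_pos hx q
  -- Bernoulli: `(1 + s)^{1−q} ≤ 1 + (1−q)s` with `s = −1∕(i+1)`
  have hb := rpow_one_add_le_one_add_mul_self (s := -(1 / ((i : ℝ) + 1))) (p := 1 - q)
    (by rw [neg_le_neg_iff, div_le_one hx]; linarith) (by linarith) (by linarith)
  have e1 : (1 : ℝ) + -(1 / ((i : ℝ) + 1)) = (i : ℝ) / ((i : ℝ) + 1) := by field_simp; ring
  rw [e1, Real.div_rpow (Nat.cast_nonneg i) hx.le] at hb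
  -- multiply by `(i+1)^{1−q} = (i+1)∕(i+1)^q`
  have hx1q : 0 < ((i : ℝ) + 1) ^ (1 - q) := Real.rpow_pos_of_pos hx _
  have e2 : ((i : ℝ) + 1) ^ (1 - q) = ((i : ℝ) + 1) / ((i : ℝ) + 1) ^ q := by
    rw [Real.rpow_sub hx, Real.rpow_one]
  have h2 := mul_le_mul_of_nonneg_left hb hx1q.le
  rw [mul_div_cancel₀ _ hx1q.ne'] at h2
  -- `(i+1)^{1−q}·(1 + (1−q)(−1∕(i+1))) = (i+1)^{1−q} − (1−q)∕(i+1)^q`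
  have e3 : ((i : ℝ) + 1) ^ (1 - q) * (1 + (1 - q) * -(1 / ((i : ℝ) + 1)))
      = ((i : ℝ) + 1) ^ (1 - q) - (1 - q) / ((i : ℝ) + 1) ^ q := by
    rw [e2]; field_simp; ring
  rw [e3] at h2
  linarith

/-- THE `q`-HEAD: `Σ_{i<N} 1∕(i+1)^q ≤ N^{1−q}∕(1−q)` for `0 < q < 1`. [folklore] -/
theorem sum_head_le {q : ℝ} (hq0 : 0 < q) (hq1 : q < 1) (N : ℕ) :
    ∑ i ∈ range N, 1 / ((i : ℝ) + 1) ^ q ≤ (N : ℝ) ^ (1 - q) / (1 - q) := by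
  have h1q : 0 < 1 - q := by linarith
  have hsum : ∑ i ∈ range N, (1 - q) / ((i : ℝ) + 1) ^ q ≤ (N : ℝ) ^ (1 - q) := by
    calc ∑ i ∈ range N, (1 - q) / ((i : ℝ) + 1) ^ q
        ≤ ∑ i ∈ range N, (((i : ℝ) + 1) ^ (1 - q) - (i : ℝ) ^ (1 - q)) := sum_le_sum fun i _ => head_step hq0 hq1 i
      _ = (N : ℝ) ^ (1 - q) - (0 : ℝ) ^ (1 - q) := by
          have := Finset.sum_range_sub (fun i : ℕ => (i : ℝ) ^ (1 - q)) N
          simpa [Nat.cast_succ] using this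
      _ = (N : ℝ) ^ (1 - q) := by rw [Real.zero_rpow h1q.ne', sub_zero]
  rw [le_div_iff₀ h1q]
  calc (∑ i ∈ range N, 1 / ((i : ℝ) + 1) ^ q) * (1 - q) = ∑ i ∈ range N, (1 - q) / ((i : ℝ) + 1) ^ q := by
        rw [Finset.sum_mul]; exact sum_congr rfl fun i _ => by ring
    _ ≤ (N : ℝ) ^ (1 - q) := hsum

/-- BERNOULLI STEP FOR THE `(1+q)`-TAIL: for `0 < q ≤ 1` and real `v ≥ 2`, `q∕(v^q·v) ≤ 1∕(v−1)^q − 1∕v^q`. [folklore] -/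
theorem tail_step {q v : ℝ} (hq0 : 0 < q) (hq1 : q ≤ 1) (hv : 2 ≤ v) :
    q / (v ^ q * v) ≤ 1 / (v - 1) ^ q - 1 / v ^ q := by
  have hv0 : 0 < v := by linarith
  have hv1 : 0 < v - 1 := by linarith
  have hvq : 0 < v ^ q := Real.rpow_pos_of_pos hv0 q
  have hv1q : 0 < (v - 1) ^ q := Real.rpow_pos_of_pos hv1 q
  -- Bernoulli: `(1 − 1∕v)^q ≤ 1 − q∕v`
  have hb := rpow_one_add_le_one_add_mul_self (s := -(1 / v)) (p := q)
    (by rw [neg_le_neg_iff, div_le_one hv0]; linarith) hq0.le hq1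
  have e1 : (1 : ℝ) + -(1 / v) = (v - 1) / v := by field_simp; ring
  rw [e1, Real.div_rpow hv1.le hv0.le] at hb
  -- `(v−1)^q ≤ v^q·(1 − q∕v)`
  have h1 : (v - 1) ^ q ≤ v ^ q * (1 + q * -(1 / v)) := by
    have := mul_le_mul_of_nonneg_left hb hvq.le
    rwa [mul_div_cancel₀ _ hvq.ne'] at this
  have hy : 0 < 1 + q * -(1 / v) := by
    have : q / v ≤ 1 / 2 := by rw [div_le_iff₀ hv0]; nlinarith
    have e : q * -(1 / v) = -(q / v) := by ring
    rw [e]; linarith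
  -- `1∕(v−1)^q ≥ 1∕(v^q(1 − q∕v)) ≥ (1 + q∕v)∕v^q`
  have h2 : 1 / (v ^ q * (1 + q * -(1 / v))) ≤ 1 / (v - 1) ^ q := one_div_le_one_div_of_le hv1q h1
  have h3 : (1 + q / v) / v ^ q ≤ 1 / (v ^ q * (1 + q * -(1 / v))) := by
    rw [div_le_div_iff₀ hvq (mul_pos hvq hy)]
    have hx : 0 ≤ q / v := by positivity
    have e : q * -(1 / v) = -(q / v) := by ring
    rw [e]
    nlinarith [mul_nonneg hvq.le (mul_nonneg hx hx)]
  have e4 : (1 + q / v) / v ^ q = 1 / v ^ q + q / (v ^ q * v) := by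
    field_simp
  linarith [h3.trans h2]

/-- THE `(1+q)`-TAIL: `Σ_{t<N} 1∕((t+2)^q·(t+2)) ≤ 1∕q` for `0 < q ≤ 1` (telescoping from `v = 2`). [folklore] -/
theorem sum_tail_le {q : ℝ} (hq0 : 0 < q) (hq1 : q ≤ 1) (N : ℕ) :
    ∑ t ∈ range N, 1 / ((((t : ℝ) + 2) ^ q) * ((t : ℝ) + 2)) ≤ 1 / q := by
  have hsum : ∑ t ∈ range N, q / ((((t : ℝ) + 2) ^ q) * ((t : ℝ) + 2)) ≤ 1 := by
    calc ∑ t ∈ range N, q / ((((t : ℝ) + 2) ^ q) * ((t : ℝ) + 2))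
        ≤ ∑ t ∈ range N, (1 / ((t : ℝ) + 1) ^ q - 1 / ((t : ℝ) + 2) ^ q) := by
          refine sum_le_sum fun t _ => ?_
          have h := tail_step (v := (t : ℝ) + 2) hq0 hq1 (by have : (0:ℝ) ≤ t := Nat.cast_nonneg t; linarith)
          rwa [show (t : ℝ) + 2 - 1 = (t : ℝ) + 1 by ring] at h
      _ = ∑ t ∈ range N, ((fun t : ℕ => 1 / ((t : ℝ) + 1) ^ q) t - (fun t : ℕ => 1 / ((t : ℝ) + 1) ^ q) (t + 1)) := by
          refine sum_congr rfl fun t _ => ?_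
          have e : ((t + 1 : ℕ) : ℝ) + 1 = (t : ℝ) + 2 := by push_cast; ring
          simp only [e]
      _ = 1 / (((0 : ℕ) : ℝ) + 1) ^ q - 1 / ((N : ℝ) + 1) ^ q := Finset.sum_range_sub' _ N
      _ ≤ 1 := by
          rw [Nat.cast_zero, zero_add, Real.one_rpow, div_one]
          have : 0 ≤ 1 / ((N : ℝ) + 1) ^ q := by positivity
          linarith
  rw [le_div_iff₀ hq0]
  calc (∑ t ∈ range N, 1 / ((((t : ℝ) + 2) ^ q) * ((t : ℝ) + 2))) * q
      = ∑ t ∈ range N, q / ((((t : ℝ) + 2) ^ q) * ((t : ℝ) + 2)) := by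
        rw [Finset.sum_mul]; exact sum_congr rfl fun t _ => by ring
    _ ≤ 1 := hsum

/-! ## §2 Abel summation of the `min(a,K)²`-moment against the tails -/

/-- `min(a,K)² = Σ_{k<K} [k < a]·(2k+1)`. [folklore] -/
theorem minSq_eq_sum (a K : ℕ) :
    (min (a : ℝ) K) ^ 2 = ∑ k ∈ range K, if k < a then (2 * (k : ℝ) + 1) else 0 := by
  rw [← Finset.sum_filter]
  have hset : (range K).filter (fun k => k < a) = range (min a K) := by
    ext k; simp only [Finset.mem_filter, Finset.mem_range, lt_min_iff]; omega
  -- `Σ_{k<m} (2k+1) = m²` (the tree's `QuantumLattice.sum_range_two_mul_cast_add_one`, re-derived inline to keep the imports light)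
  have hodd : ∀ m : ℕ, ∑ k ∈ range m, (2 * (k : ℝ) + 1) = (m : ℝ) ^ 2 := by
    intro m
    induction m with
    | zero => simp
    | succ m ih => rw [Finset.sum_range_succ, ih]; push_cast; ring
  rw [hset, hodd, ← Nat.cast_min]

/-- ABEL: `Σ_{a<N} ρ(a)·min(a,K)² = Σ_{k<K} (2k+1)·Σ_{a∈[k+1,N)} ρ(a)`. [folklore] -/
theorem sum_minSq_eq (ρ : ℕ → ℝ) (K N : ℕ) :
    ∑ a ∈ range N, ρ a * (min (a : ℝ) K) ^ 2 = ∑ k ∈ range K, (2 * (k : ℝ) + 1) * ∑ a ∈ Ico (k + 1) N, ρ a := by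
  have h1 : ∀ a ∈ range N, ρ a * (min (a : ℝ) K) ^ 2 = ∑ k ∈ range K, if k < a then ρ a * (2 * (k : ℝ) + 1) else 0 := by
    intro a _
    rw [minSq_eq_sum, Finset.mul_sum]
    exact sum_congr rfl fun k _ => by split_ifs <;> simp
  rw [sum_congr rfl h1, Finset.sum_comm]
  refine sum_congr rfl fun k _ => ?_
  rw [Finset.mul_sum, ← Finset.sum_filter]
  have hset : (range N).filter (fun a => k < a) = Ico (k + 1) N := by
    ext a; simp only [Finset.mem_filter, Finset.mem_range, Finset.mem_Ico]; omega
  rw [hset]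
  exact sum_congr rfl fun a _ => by ring

/-- ABEL AGAINST A TAIL MAJORANT: `ρ ≥ 0`, `R(N) − R(k) ≤ τ(k)` (`k ≤ N`), `τ ≥ 0` ⟹ `Σ_{a<N} ρ(a)min(a,K)² ≤ Σ_{k<K} (2k+1)·τ(k+1)`. [folklore] -/
theorem sum_minSq_le_tails {ρ τ : ℕ → ℝ} (hτ0 : ∀ k, 0 ≤ τ k)
    (hτ : ∀ k N, k ≤ N → ∑ a ∈ range N, ρ a - ∑ a ∈ range k, ρ a ≤ τ k) (K N : ℕ) :
    ∑ a ∈ range N, ρ a * (min (a : ℝ) K) ^ 2 ≤ ∑ k ∈ range K, (2 * (k : ℝ) + 1) * τ (k + 1) := by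
  rw [sum_minSq_eq]
  refine sum_le_sum fun k _ => mul_le_mul_of_nonneg_left ?_ (by positivity)
  rcases le_or_gt (k + 1) N with h | h
  · rw [Finset.sum_Ico_eq_sub _ h]; exact hτ (k + 1) N h
  · rw [Finset.Ico_eq_empty (by omega), Finset.sum_empty]; exact hτ0 _

/-! ## §3 The two shapes of the third file for power tails `τ(k) = T₀∕(k+1)^q`, `0 < q < 1` -/

/-- `x^{1−q} = x ∕ x^q` for `x > 0`. [folklore] -/
theorem rpow_one_sub_eq {x q : ℝ} (hx : 0 < x) : x ^ (1 - q) = x / x ^ q := by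
  rw [Real.rpow_sub hx, Real.rpow_one]

/-- SHAPE (T1) WITH `A₁ = 4`: if `R(N) − R(k) ≤ T₀∕(k+1)^q` (`k ≤ N`, `T₀ ≥ 0`, `0 < q < 1`), then for `K ≥ 1`:
`Σ_{a<N} ρ(a)min(a,K)² ≤ 4·K²·(T₀∕(K+1)^q)`. [folklore] -/
theorem powerTail_T1 {ρ : ℕ → ℝ} {T₀ q : ℝ} (hq0 : 0 < q) (hq1 : q < 1) (hT₀ : 0 ≤ T₀)
    (hτ : ∀ k N, k ≤ N → ∑ a ∈ range N, ρ a - ∑ a ∈ range k, ρ a ≤ T₀ / ((k : ℝ) + 1) ^ q)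
    (K N : ℕ) (hK : 1 ≤ K) :
    ∑ a ∈ range N, ρ a * (min (a : ℝ) K) ^ 2 ≤ 4 * (K : ℝ) ^ 2 * (T₀ / ((K : ℝ) + 1) ^ q) := by
  have hKr : (1 : ℝ) ≤ K := by exact_mod_cast hK
  have hK1 : (0 : ℝ) < (K : ℝ) + 1 := by linarith
  have hK1q : 0 < ((K : ℝ) + 1) ^ q := Real.rpow_pos_of_pos hK1 q
  have h1 := sum_minSq_le_tails (τ := fun k => T₀ / ((k : ℝ) + 1) ^ q) (fun k => by positivity) hτ K N
  refine h1.trans ?_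
  -- each term: `(2k+1)·T₀∕(k+2)^q ≤ 2T₀·(K+1)^{1−q}`
  have hterm : ∀ k ∈ range K, (2 * (k : ℝ) + 1) * (T₀ / ((((k + 1 : ℕ) : ℝ)) + 1) ^ q)
      ≤ 2 * T₀ * (((K : ℝ) + 1) / ((K : ℝ) + 1) ^ q) := by
    intro k hk
    have hk' : k < K := Finset.mem_range.mp hk
    have hx : (0 : ℝ) < (k : ℝ) + 2 := by positivity
    have hxq : 0 < ((k : ℝ) + 2) ^ q := Real.rpow_pos_of_pos hx q
    have e : (((k + 1 : ℕ) : ℝ)) + 1 = (k : ℝ) + 2 := by push_cast; ring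
    rw [e]
    -- `(2k+1)∕(k+2)^q ≤ 2(k+2)∕(k+2)^q = 2(k+2)^{1−q} ≤ 2(K+1)^{1−q}`
    have hkK : (k : ℝ) + 2 ≤ (K : ℝ) + 1 := by
      have : (k : ℝ) + 1 ≤ K := by exact_mod_cast hk'
      linarith
    have hmono : ((k : ℝ) + 2) ^ (1 - q) ≤ ((K : ℝ) + 1) ^ (1 - q) := Real.rpow_le_rpow hx.le hkK (by linarith)
    rw [rpow_one_sub_eq hx, rpow_one_sub_eq hK1] at hmono
    have h2 : (2 * (k : ℝ) + 1) * (T₀ / ((k : ℝ) + 2) ^ q) ≤ 2 * T₀ * (((k : ℝ) + 2) / ((k : ℝ) + 2) ^ q) := by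
      rw [show 2 * T₀ * (((k : ℝ) + 2) / ((k : ℝ) + 2) ^ q) = (2 * (k : ℝ) + 4) * (T₀ / ((k : ℝ) + 2) ^ q) by ring]
      exact mul_le_mul_of_nonneg_right (by linarith) (by positivity)
    exact h2.trans (mul_le_mul_of_nonneg_left hmono (by positivity))
  calc ∑ k ∈ range K, (2 * (k : ℝ) + 1) * (T₀ / ((((k + 1 : ℕ) : ℝ)) + 1) ^ q)
      ≤ ∑ k ∈ range K, 2 * T₀ * (((K : ℝ) + 1) / ((K : ℝ) + 1) ^ q) := sum_le_sum hterm
    _ = 2 * T₀ * (K : ℝ) * ((K : ℝ) + 1) / ((K : ℝ) + 1) ^ q := by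
        rw [Finset.sum_const, Finset.card_range, nsmul_eq_mul]; ring
    _ ≤ 4 * (K : ℝ) ^ 2 * (T₀ / ((K : ℝ) + 1) ^ q) := by
        rw [show 4 * (K : ℝ) ^ 2 * (T₀ / ((K : ℝ) + 1) ^ q) = 2 * T₀ * (K : ℝ) * (2 * K) / ((K : ℝ) + 1) ^ q by ring]
        refine div_le_div_of_nonneg_right ?_ hK1q.le
        have : 0 ≤ 2 * T₀ * (K : ℝ) := by positivity
        nlinarith

/-- SHAPE (T2) WITH `A₂ = T₀(4∕(1−q) + 2∕q)` for `τ(k) = T₀∕(k+1)^q`, `0 < q < 1`, `T₀ ≥ 0`: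
`Σ_{i<j₀} τ(i+1)τ(j₀−i)∕(j₀+1−i) ≤ T₀(4∕(1−q) + 2∕q)·τ(j₀+1)`. [folklore] -/
theorem powerTail_T2 {T₀ q : ℝ} (hq0 : 0 < q) (hq1 : q < 1) (j₀ : ℕ) :
    ∑ i ∈ range j₀, (T₀ / ((((i + 1 : ℕ) : ℝ)) + 1) ^ q) * (T₀ / ((((j₀ - i : ℕ) : ℝ)) + 1) ^ q)
        / ((j₀ + 1 - i : ℕ) : ℝ)
      ≤ T₀ * (4 / (1 - q) + 2 / q) * (T₀ / ((((j₀ + 1 : ℕ) : ℝ)) + 1) ^ q) := by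
  set h : ℕ := j₀ / 2 with hh
  have h1q : 0 < 1 - q := by linarith
  set w : ℝ := (j₀ : ℝ) + 2 with hw
  have hw0 : 0 < w := by rw [hw]; positivity
  have hw2 : (2 : ℝ) ≤ w := by rw [hw]; have : (0 : ℝ) ≤ j₀ := Nat.cast_nonneg _; linarith
  have hwq : 0 < w ^ q := Real.rpow_pos_of_pos hw0 q
  have hwq1 : 1 ≤ w ^ q := Real.one_le_rpow (by linarith) hq0.le
  have h2q : (2 : ℝ) ^ q ≤ 2 := by
    have := Real.rpow_le_rpow_of_exponent_le (x := 2) (by norm_num) hq1.le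
    rwa [Real.rpow_one] at this
  have h2q0 : 0 < (2 : ℝ) ^ q := Real.rpow_pos_of_pos (by norm_num) q
  have ej : (((j₀ + 1 : ℕ) : ℝ)) + 1 = w := by rw [hw]; push_cast; ring
  rw [ej]
  -- the two majorants
  set cA : ℝ := T₀ ^ 2 * (4 / (w ^ q * w)) with hcA
  set cB : ℝ := T₀ ^ 2 * (2 / w ^ q) with hcB
  have hcA0 : 0 ≤ cA := by positivity
  have hcB0 : 0 ≤ cB := by positivity
  set fA : ℕ → ℝ := fun i => if i ≤ h then cA * (1 / ((i : ℝ) + 1) ^ q) else 0 with hfA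
  set fB : ℕ → ℝ := fun i => cB * (1 / ((((j₀ + 1 - i : ℕ) : ℝ) ^ q) * ((j₀ + 1 - i : ℕ) : ℝ))) with hfB
  -- termwise
  have hterm : ∀ i ∈ range j₀, (T₀ / ((((i + 1 : ℕ) : ℝ)) + 1) ^ q) * (T₀ / ((((j₀ - i : ℕ) : ℝ)) + 1) ^ q)
        / ((j₀ + 1 - i : ℕ) : ℝ) ≤ fA i + fB i := by
    intro i hi
    have hi' := Finset.mem_range.mp hi
    have ei : (((i + 1 : ℕ) : ℝ)) + 1 = (i : ℝ) + 2 := by push_cast; ring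
    have ev : (((j₀ - i : ℕ) : ℝ)) + 1 = ((j₀ + 1 - i : ℕ) : ℝ) := by
      rw [show j₀ + 1 - i = (j₀ - i) + 1 by omega]; push_cast; ring
    rw [ei, ev]
    set v : ℝ := ((j₀ + 1 - i : ℕ) : ℝ) with hv
    have hv0 : (0 : ℝ) < v := by rw [hv]; exact_mod_cast (by omega : 0 < j₀ + 1 - i)
    have hvq : 0 < v ^ q := Real.rpow_pos_of_pos hv0 q
    have hx : (0 : ℝ) < (i : ℝ) + 2 := by positivity
    have hxq : 0 < ((i : ℝ) + 2) ^ q := Real.rpow_pos_of_pos hx q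
    have hx1 : (0 : ℝ) < (i : ℝ) + 1 := by positivity
    have hx1q : 0 < ((i : ℝ) + 1) ^ q := Real.rpow_pos_of_pos hx1 q
    have eterm : (T₀ / ((i : ℝ) + 2) ^ q) * (T₀ / v ^ q) / v = T₀ ^ 2 * (1 / ((i : ℝ) + 2) ^ q) * (1 / (v ^ q * v)) := by
      field_simp
    rw [eterm]
    have hfA0 : 0 ≤ fA i := by simp only [hfA]; split_ifs <;> positivity
    have hfB0 : 0 ≤ fB i := by simp only [hfB]; positivity
    by_cases hih : i ≤ h
    · -- young: `v ≥ w∕2`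
      have hvw : w / 2 ≤ v := by
        rw [hw, hv]
        have : (j₀ : ℝ) + 2 ≤ 2 * ((j₀ + 1 - i : ℕ) : ℝ) := by exact_mod_cast (by omega : j₀ + 2 ≤ 2 * (j₀ + 1 - i))
        linarith
      have hw2' : 0 < w / 2 := by positivity
      have hvv : (w / 2) ^ q * (w / 2) ≤ v ^ q * v :=
        mul_le_mul (Real.rpow_le_rpow hw2'.le hvw hq0.le) hvw hw2'.le hvq.le
      have hA1 : 1 / (v ^ q * v) ≤ 1 / ((w / 2) ^ q * (w / 2)) :=
        one_div_le_one_div_of_le (mul_pos (Real.rpow_pos_of_pos hw2' q) hw2') hvv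
      have hA2 : 1 / ((w / 2) ^ q * (w / 2)) ≤ 4 / (w ^ q * w) := by
        rw [Real.div_rpow hw0.le (by norm_num : (0:ℝ) ≤ 2), div_le_div_iff₀ (by positivity) (by positivity)]
        -- `w^q·w ≤ 4·(w^q∕2^q·(w∕2))` iff `2^q ≤ 2`
        have : w ^ q * w * 2 ^ q ≤ w ^ q * w * 2 := mul_le_mul_of_nonneg_left h2q (by positivity)
        field_simp
        nlinarith [this]
      have hA3 : 1 / ((i : ℝ) + 2) ^ q ≤ 1 / ((i : ℝ) + 1) ^ q :=
        one_div_le_one_div_of_le hx1q (Real.rpow_le_rpow hx1.le (by linarith) hq0.le)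
      calc T₀ ^ 2 * (1 / ((i : ℝ) + 2) ^ q) * (1 / (v ^ q * v))
          ≤ T₀ ^ 2 * (1 / ((i : ℝ) + 1) ^ q) * (4 / (w ^ q * w)) :=
            mul_le_mul (mul_le_mul_of_nonneg_left hA3 (by positivity)) (hA1.trans hA2) (by positivity) (by positivity)
        _ = fA i := by simp only [hfA, if_pos hih, hcA]; ring
        _ ≤ fA i + fB i := by linarith
    · -- old: `i + 2 ≥ w∕2`
      rw [not_le] at hih
      have hiw : w / 2 ≤ (i : ℝ) + 2 := by
        rw [hw]
        have : (j₀ : ℝ) < 2 * ((i : ℝ) + 1) := by exact_mod_cast (by omega : j₀ < 2 * (i + 1))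
        linarith
      have hw2' : 0 < w / 2 := by positivity
      have hB1 : 1 / ((i : ℝ) + 2) ^ q ≤ 1 / (w / 2) ^ q :=
        one_div_le_one_div_of_le (Real.rpow_pos_of_pos hw2' q) (Real.rpow_le_rpow hw2'.le hiw hq0.le)
      have hB2 : 1 / (w / 2) ^ q ≤ 2 / w ^ q := by
        rw [Real.div_rpow hw0.le (by norm_num : (0:ℝ) ≤ 2), one_div_div]
        exact div_le_div_of_nonneg_right h2q hwq.le
      calc T₀ ^ 2 * (1 / ((i : ℝ) + 2) ^ q) * (1 / (v ^ q * v))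
          ≤ T₀ ^ 2 * (2 / w ^ q) * (1 / (v ^ q * v)) :=
            mul_le_mul_of_nonneg_right (mul_le_mul_of_nonneg_left (hB1.trans hB2) (by positivity)) (by positivity)
        _ = fB i := by simp only [hfB, hcB, hv]
        _ ≤ fA i + fB i := by linarith
  -- the young half against the `q`-head
  have hA : ∑ i ∈ range j₀, fA i ≤ cA * (w / w ^ q / (1 - q)) := by
    have hsub : ∑ i ∈ range j₀, fA i ≤ ∑ i ∈ range (h + 1), cA * (1 / ((i : ℝ) + 1) ^ q) := by
      calc ∑ i ∈ range j₀, fA i = ∑ i ∈ (range j₀).filter (fun i => i ≤ h), cA * (1 / ((i : ℝ) + 1) ^ q) := by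
            rw [Finset.sum_filter]
        _ ≤ ∑ i ∈ range (h + 1), cA * (1 / ((i : ℝ) + 1) ^ q) := by
            refine Finset.sum_le_sum_of_subset_of_nonneg ?_ fun i _ _ => by positivity
            intro i hi
            have := (Finset.mem_filter.mp hi).2
            exact Finset.mem_range.mpr (by omega)
    have hhead := sum_head_le hq0 hq1 (h + 1)
    have hhw : ((h + 1 : ℕ) : ℝ) ^ (1 - q) ≤ w ^ (1 - q) :=
      Real.rpow_le_rpow (by positivity) (by rw [hw]; exact_mod_cast (by omega : h + 1 ≤ j₀ + 2)) h1q.le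
    rw [rpow_one_sub_eq hw0] at hhw
    calc ∑ i ∈ range j₀, fA i ≤ ∑ i ∈ range (h + 1), cA * (1 / ((i : ℝ) + 1) ^ q) := hsub
      _ = cA * ∑ i ∈ range (h + 1), 1 / ((i : ℝ) + 1) ^ q := by rw [Finset.mul_sum]
      _ ≤ cA * ((((h + 1 : ℕ) : ℝ)) ^ (1 - q) / (1 - q)) := mul_le_mul_of_nonneg_left hhead hcA0
      _ ≤ cA * (w / w ^ q / (1 - q)) := mul_le_mul_of_nonneg_left (div_le_div_of_nonneg_right hhw h1q.le) hcA0
  -- the old half against the `(1+q)`-tail, reflected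
  have hB : ∑ i ∈ range j₀, fB i ≤ cB * (1 / q) := by
    have hrefl : ∑ i ∈ range j₀, 1 / ((((j₀ + 1 - i : ℕ) : ℝ) ^ q) * ((j₀ + 1 - i : ℕ) : ℝ))
        = ∑ t ∈ range j₀, 1 / ((((t : ℝ) + 2) ^ q) * ((t : ℝ) + 2)) := by
      rw [← Finset.sum_range_reflect (fun t : ℕ => 1 / ((((t : ℝ) + 2) ^ q) * ((t : ℝ) + 2))) j₀]
      refine Finset.sum_congr rfl fun i hi => ?_
      have hi' := Finset.mem_range.mp hi
      have e : ((j₀ + 1 - i : ℕ) : ℝ) = ((j₀ - 1 - i : ℕ) : ℝ) + 2 := by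
        rw [show j₀ + 1 - i = (j₀ - 1 - i) + 2 by omega]; push_cast; ring
      rw [e]
    calc ∑ i ∈ range j₀, fB i = cB * ∑ i ∈ range j₀, 1 / ((((j₀ + 1 - i : ℕ) : ℝ) ^ q) * ((j₀ + 1 - i : ℕ) : ℝ)) := by
          rw [Finset.mul_sum]
      _ ≤ cB * (1 / q) := by rw [hrefl]; exact mul_le_mul_of_nonneg_left (sum_tail_le hq0 hq1.le j₀) hcB0
  have hsum2 : ∑ i ∈ range j₀, (fA i + fB i) ≤ cA * (w / w ^ q / (1 - q)) + cB * (1 / q) := by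
    rw [Finset.sum_add_distrib]; exact add_le_add hA hB
  refine ((Finset.sum_le_sum hterm).trans hsum2).trans ?_
  -- algebra: `cA·(w∕w^q)∕(1−q) = 4T₀²∕((1−q)·w^q·w^q) ≤ 4T₀²∕((1−q)w^q)` and `cB∕q = 2T₀²∕(q w^q)`
  have e1 : cA * (w / w ^ q / (1 - q)) = (4 * T₀ ^ 2 / ((1 - q) * w ^ q)) * (1 / w ^ q) := by
    simp only [hcA]; field_simp
  have e2 : cB * (1 / q) = 2 * T₀ ^ 2 / (q * w ^ q) := by simp only [hcB]; field_simp
  have h3 : (4 * T₀ ^ 2 / ((1 - q) * w ^ q)) * (1 / w ^ q) ≤ 4 * T₀ ^ 2 / ((1 - q) * w ^ q) := by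
    have h1w : 1 / w ^ q ≤ 1 := by rw [div_le_one hwq]; exact hwq1
    have := mul_le_mul_of_nonneg_left h1w (by positivity : 0 ≤ 4 * T₀ ^ 2 / ((1 - q) * w ^ q))
    rwa [mul_one] at this
  rw [e1, e2]
  calc 4 * T₀ ^ 2 / ((1 - q) * w ^ q) * (1 / w ^ q) + 2 * T₀ ^ 2 / (q * w ^ q)
      ≤ 4 * T₀ ^ 2 / ((1 - q) * w ^ q) + 2 * T₀ ^ 2 / (q * w ^ q) := by linarith
    _ = T₀ * (4 / (1 - q) + 2 / q) * (T₀ / w ^ q) := by field_simp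

end Summit.QuantumFields.BalabanUV.Beta.RemainderExplicitHistoryDiagonalRatePowerShapes

end
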